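import Literature.AlgebraicGeometry.HodgeTheory.TimesLowGenericInvariance
import Literature.AlgebraicGeometry.HodgeTheory.NoTypeIVTimesCMProductSpan
import Literature.AlgebraicGeometry.HodgeTheory.NoTypeIVTimesCMStablyNondegenerate
import Literature.AlgebraicGeometry.HodgeTheory.AbelianThreefoldsStablyNondegenerate
import Literature.AlgebraicGeometry.HodgeTheory.FiniteProductsMixedPowersRetract
import Literature.AlgebraicGeometry.HodgeTheory.EllipticCurvesCMTypeProductsHodgeConjecture
import Literature.AlgebraicGeometry.Motives.AbelianVarietyKernelComponent
import Literature.AlgebraicGeometry.Motives.AbelianVarietyIsogenyCancellation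
import Literature.AlgebraicGeometry.Motives.AbelianVarietySimpleOfEndAlgebraDomain
import Literature.NumberTheory.ComplexMultiplication.EllipticCurveEndomorphismRingStructure
import HarnessLib

/-!
# `HodgeClassesProductSpan (A^{N+1}) (S^{N+1})` and condition (D) for `A × S`, `S` of dimension `≤ 3` with `End⁰(S) = ℚ` and `Hom(A, S) = 0` (Moonen–Zarhin 1999 Lemma (3.4) with (2.4) and (3.1)); every `Y × S` with `dim Y ≤ 3` and `S` a generic abelian surface or threefold satisfies (D) (Thm. 0.1 (4), Thm. 0.2 (4))

Family `hodge`, layer `Literature/AlgebraicGeometry/HodgeTheory`. Research context: cell `pub-hodge-ring2`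
(HONEST FRAMING: research route conditional on HC_CM; not a corollary; Q11.4-sentence-2 already refuted in
dim ≥ 3), Literature lane, programme R23 («`X × S` for `S` a non-CM elliptic curve, a GENERIC abelian surface or
a GENERIC abelian threefold — `End⁰(S) = ℚ` — and ANY `X` with `Hom(X, S) = 0`»). UNCONDITIONAL; theorems only,
no definition, no named fact; no step towards a summit statement beyond the published theorems it formalizes.
This file is the COMPANION of `NoTypeIVTimesCMProductSpan` (programme R5) and of `TimesNonCMCurveProductSpan`
(programme R22, the case `dim S = 1`), fed by the invariance theorem
`AVSlots.exists_coeff_eq_zero_off_balanced_of_prod_lowGeneric` (`TimesLowGenericInvariance`).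

PRINTED RESULTS. B. Moonen, Yu. G. Zarhin, *Hodge classes on abelian varieties of low dimension*, Math. Ann.
**315** (1999) 711–733 [corpus: paper:arxiv-math_9901113]. §3 (3.1) [p. 6]: `Hg(X₁ × X₂) = Hg(X₁) × Hg(X₂)`
fails «if and only if for some `m` and `n` the Hodge ring `B(X₁^m × X₂^n)` is not generated by the elements
coming from `B(X₁^m)` and `B(X₂^n)`»; Lemma (3.4) [p. 6 L133–L140, p. 7 L1–L8]: «Let `X₁` and `X₂` be nonzero
complex abelian varieties. Write `X = X₁ × X₂`. Assume that `hg(X₂)` is a `ℚ`-simple Lie algebra of non-compact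
type and that, up to isomorphism, `V_{X₂}` is the only irreducible `hg(X₂)`-module which is a length 1
representation of non-compact type. Then either `Hg(X) = Hg(X₁) × Hg(X₂)` or `Hom(X₂, X₁) ≠ 0`»; (2.4)(3)
[p. 5 L113–L124]: for `X` simple of dimension `≤ 3` not of CM-type, `Hg(X)` is `ℚ`-simple (except `dim X = 3`,
`End⁰(X)` imaginary quadratic) and then «there is exactly one faithful irreducible representation of `hg(X)` over
`ℚ` which is of length 1»; (5.4) [p. 9]: «If `dim(X₂) < 3` then the desired equality `Hg(X) = Hg(X₁) × Hg(X₂)`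
follows from (2.4) and (3.4)»; Thm. (3.2) / §3 first paragraph: if both factors satisfy (D) (`B• = D•` on all
powers) and `Hg` splits, the product satisfies (D); Thm. 0.1 (4) [p. 1 L113–L117] (`dim X ≤ 4`: (D) outside the
cases (a)–(d)) and Thm. 0.2 (4) [p. 2 L40–L47] (`dim X = 5`: outside the cases (e)–(g), «if `X` has no simple
factor of dimension 4 then `Hg(X) = Sp_D(V,φ)` and `B•(Xⁿ) = D•(Xⁿ)` for every `n ≥ 1`»). None of the exceptional
cases (a)–(g) has an isogeny factor `S` with `dim S ∈ {2, 3}` and `End⁰(S) = ℚ` [p. 1 L77–L92, p. 1 L127–L140].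

MAIN RESULTS (all proved):
* `hodgeClassesProductSpan_of_avSlots_of_lowGeneric`: for `B` with `n` slots over `A` and `Z` with `n` slots over
  `S` (`0 < dim S ≤ 3`, `finrank_ℚ End⁰(S) = 1`, no non-zero morphism of Hodge structures `H¹(S) → H¹(A)`),
  every rational `(p,p)`-class on `B × Z` is a `ℂ`-combination of exterior products of RATIONAL HODGE classes —
  in particular `HodgeClassesProductSpan (A^{N+1}) (S^{N+1})` for all `N`
  (`hodgeClassesProductSpan_powSucc_powSucc_of_lowGeneric`, `…_of_forall_hom_eq_zero` with «`Hom(A, S) = 0`»);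
* `IsStablyNondegenerate.prod_lowGeneric_of_forall_hom_eq_zero`: if `A` satisfies condition (D), so does `A × S`
  (and `S × A`, and all `A^{a+1} × S^{b+1}`) — `S` itself is (D) by the dimension-`≤ 3` theorem;
* THE ROW `isStablyNondegenerate_prod_lowGeneric_of_dim_le_three`: for ALL complex abelian varieties `T`, `S`
  with `0 < dim T ≤ 3`, `0 < dim S ≤ 3`, `End⁰(S) = ℚ` and `Hom(T, S) = 0`, the product `T × S` (of dimension
  `≤ 6`) satisfies (D); hence the Hodge conjecture for all powers `(T × S)^{N+1}` and everything isogenous to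
  them — UNCONDITIONALLY;
* NO `Hom` HYPOTHESIS (§3, Poincaré case analyses): `isStablyNondegenerate_prod_genericSurface_of_dim_le_two`
  (`Y × S`, `0 < dim Y ≤ 2`, `S` a surface with `End⁰(S) = ℚ` — abelian threefolds and FOURFOLDS),
  `isStablyNondegenerate_threefold_prod_genericSurface` (`T × S`, `dim T = 3` — FIVEFOLDS, Thm. 0.2 (4)),
  `isStablyNondegenerate_prod_genericThreefold_of_dim_le_two` (`Y × T'`, `0 < dim Y ≤ 2`, `T'` a threefold with
  `End⁰(T') = ℚ` — fourfolds and fivefolds), `isStablyNondegenerate_threefold_prod_genericThreefold` (`T × T'`,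
  `dim T = 3` — SIXFOLDS): all these products, everything isogenous to them and all their powers satisfy (D) and
  the Hodge conjecture, UNCONDITIONALLY.

PROOF. §1 = the companion's §1 verbatim (evaluation into typed cup products,
`wordEval_mem_span_typed_cup_pureType_of_eq_zero_off_balanced`, and the typed Künneth criterion
`mem_span_hodgeProductClasses_of_mem_span_pureType`) fed by the new invariance theorem; §2 the (D) rows from
`isStablyNondegenerate_prod_of_forall_productSpan_powSucc` (Moonen–Zarhin §3 glue),
`isStablyNondegenerate_of_dim_pos_of_dim_le_three` (programmes R19–R21), `IsStablyNondegenerate.powSucc_prod_powSucc`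
and `IsStablyNondegenerate.of_isIsogenous`. §3: `End⁰(S) = ℚ` is a field, so `S` is simple
(`isSimple_of_isField_endAlgebra`); a non-zero homomorphism between simple abelian varieties is an isogeny
(`isIsogeny_of_isSimple_of_ne_zero`), so `Hom(Y, S) ≠ 0` forces `Y ∼ S` for simple `Y` (then `Y × S ∼ S × S`,
powers of `S`) and `Hom = 0` between simple varieties of different dimensions; non-simple factors are replaced by
`E₁ × E₂`, `E' × S''` (`exists_curve_prod_curve_isIsogenous_of_not_isSimple_surface`,
`exists_curve_prod_surface_isIsogenous_of_not_isSimple_threefold`); the one new shape, `T ∼ E' × S''` with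
`S'' ∼ S`, is `T × S ∼ S² × E'`, which is (D) by the §2 row for the non-CM curve `E'` (`End⁰(E') = ℚ`,
`Hom(S², E') = 0`) or, for `E'` of CM type (`finrank_endAlgebra_eq_one_or_two`,
`EllipticCurve.isOfCMType_iff_finrank_end_eq_two`), by the R5 row
`IsStablyNondegenerate.powSucc_prod_powSucc_cmCurve_of_hasNoTypeIVFactor` (`S` has no factor of Type IV:
`hasNoTypeIVFactor_of_finrank_endAlgebra_eq_one`).

## References

* [MoonenZarhin1999LowDim] B. Moonen, Yu. Zarhin, Math. Ann. 315 (1999), Thm. 0.1, Thm. 0.2, §2 (2.4), §3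
  (3.1), Thm. (3.2), Lemma (3.4), §5 (5.2), (5.4). [cite: MoonenZarhin1999LowDim, §3 Lemma (3.4)]
* [Gordon1999HodgeAVSurvey] B. B. Gordon, *A survey of the Hodge conjecture for abelian varieties*, Thm. 7.5,
  Def. 7.6, Thm. 7.6.2. [cite: Gordon1999HodgeAVSurvey, Def. 7.6]
* [vanGeemen1994HodgeAV] B. van Geemen, *An introduction to the Hodge conjecture for abelian varieties* (1994),
  §2.4, §3.6–3.7, Thm. 4.3. [cite: vanGeemen1994HodgeAV, §3.6 (p. 236)]
* [DeligneMilne1982Tannakian] P. Deligne, J. S. Milne, LNM 900 (1982), §6 Thm. 6.20. [cite: DeligneMilne1982Tannakian, §6 Thm. 6.20]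
* [MumfordAV1970] D. Mumford, *Abelian Varieties* (1970), §19 Thm. 1 (Poincaré's complete reducibility) and Cor. 2
  (pp. 173–174). [cite: MumfordAV1970, §19 Thm. 1 (pp. 173–174)]
* [SilvermanAEC2009] J. H. Silverman, *The Arithmetic of Elliptic Curves*, III.9 Cor. 9.4. [cite: SilvermanAEC2009, III.9 Cor. 9.4]
* [VoisinHodgeI2002] C. Voisin, *Hodge Theory I*, §11.3.2 Thm. 11.38. [cite: VoisinHodgeI2002, §11.3.2 Thm. 11.38]
-/

noncomputable section

open scoped TensorProduct
open CategoryTheory CategoryTheory.Limits Module MonoidalCategory CartesianMonoidalCategory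

namespace Literature.AlgebraicGeometry.HodgeTheory

open Literature.AlgebraicTopology.SingularHomology
open Literature.AlgebraicGeometry.Motives (IsSmoothProjective AbelianVariety bettiCohomology
  ofRatClassBaseChange ComplexPoints)
open Literature.AlgebraicGeometry.Motives.AbelianVariety
open Literature.AlgebraicGeometry.Milne1999 (IsOfCMType)
open Literature.AlgebraicGeometry.Motives.HodgeStructure
open Literature.AlgebraicGeometry.ComplexMultiplication
open Literature.NumberTheory.DiophantineGeometry
open Literature.Barriers.HodgeConjecture
open Literature.RepresentationTheory.GeneralLinear

/-! ### §1 `HodgeClassesProductSpan B Z` for slots over `A` and over `S`, `0 < dim S ≤ 3`, `End⁰(S) = ℚ`, `Hom_Hdg = 0` -/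

section ProductSpan

variable {A B S Z : AbelianVariety ℂ} {n : ℕ} {gB : Fin n → (B ⟶ A)} {gS : Fin n → (Z ⟶ S)}

/-- **«`Hom(A, S) = 0`» in Hodge form (Riemann; Deligne–Milne 6.20, fullness).** If every homomorphism `A → S`
vanishes, then every `ℚ`-linear `ψ : H¹(S(ℂ); ℚ) → H¹(A(ℂ); ℚ)` respecting the Hodge types `(1,0)`, `(0,1)` is
zero (the tree's `forall_isHodgeMorphismOne_eq_zero_of_forall_hom_eq_zero` of `TimesNonCMCurveInvariance`, restated
here privately to keep the import closure small). [cite: DeligneMilne1982Tannakian, §6 Thm. 6.20] -/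
private theorem forall_isHodgeMorphismOne_eq_zero_of_forall_hom_eq_zero_low (hAS : ∀ u : A ⟶ S, u = 0)
    (ψ : bettiCohomology S.X 1 →ₗ[ℚ] bettiCohomology A.X 1) (hψ : IsHodgeMorphismOne A S ψ) : ψ = 0 := by
  obtain ⟨u, k, hk, hu⟩ := deligneMilne1982_Thm_6_20_full_holds A S ψ
    (nonempty_hodgeModel_holds.nonempty AbelianVariety.isSmoothProjective_holds) hψ
  have hu' : (bettiCohomology.map u.hom.hom.hom 1).hom = (k : ℚ) • ψ := by
    apply LinearMap.ext
    intro v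
    rw [LinearMap.smul_apply, Nat.cast_smul_eq_nsmul]
    exact hu v
  rw [hAS u, bettiCohomology_map_zero_one, ModuleCat.hom_zero] at hu'
  have hk' : (k : ℚ) ≠ 0 := Nat.cast_ne_zero.2 hk.ne'
  exact (smul_eq_zero.1 hu'.symm).resolve_left hk'

/-- **`HodgeClassesProductSpan B Z` (Moonen–Zarhin Lemma (3.4) with (2.4) and (3.1) for «anything × (`S` with
`End⁰(S) = ℚ`, `dim S ≤ 3`), `Hom = 0`», PROVED with slots).** Let `S` have `0 < dim S ≤ 3` and
`finrank_ℚ End⁰(S) = 1`, let no non-zero `H¹(S(ℂ); ℚ) → H¹(A(ℂ); ℚ)` be a morphism of Hodge structures, let `B`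
have `n` slots over `A` and `Z` have `n` slots over `S` (e.g. `B = A^{N+1}`, `Z = S^{N+1}`). Then every rational
class of Hodge type `(p,p)` on `B × Z` is a `ℂ`-combination of exterior products `pr_B^* a ⌣ pr_Z^* b` of RATIONAL
HODGE classes `a` of `B` and `b` of `Z`. [cite: MoonenZarhin1999LowDim, §2 (2.4), §3 (3.1) and Lemma (3.4)]
[cite: VoisinHodgeI2002, §11.3.2 Thm. 11.38] -/
theorem hodgeClassesProductSpan_of_avSlots_of_lowGeneric (hS0 : 0 < S.dim) (hS3 : S.dim ≤ 3)
    (hSend : Module.finrank ℚ S.endAlgebra = 1)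
    (hHom : ∀ ψ : bettiCohomology S.X 1 →ₗ[ℚ] bettiCohomology A.X 1, IsHodgeMorphismOne A S ψ → ψ = 0)
    (hgB : AVSlots A B gB) (hgS : AVSlots S Z gS) :
    HodgeClassesProductSpan B Z := by
  classical
  intro p c hcQ hc
  have hB : IsSmoothProjective B.dim B.X := Motives.AbelianVariety.isSmoothProjective_holds
  have hZ : IsSmoothProjective Z.dim Z.X := Motives.AbelianVariety.isSmoothProjective_holds
  have hXA : IsSmoothProjective A.dim A.X := Motives.AbelianVariety.isSmoothProjective_holds
  have hXS : IsSmoothProjective S.dim S.X := Motives.AbelianVariety.isSmoothProjective_holds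
  obtain ⟨hA, bA, h, cS, hbA0, hbA1, hcS0, hcS1, hmain⟩ :=
    (hgB.prodLift hgS).exists_coeff_eq_zero_off_balanced_of_prod_lowGeneric hS0 hS3 hSend hHom
  have hc' : IsOfHodgeType (B.prod Z).dim (B.prod Z).X (2 * p) p p c := by
    rw [Motives.AbelianVariety.dim_prod]; exact hc
  rcases Nat.eq_zero_or_pos p with rfl | hp
  · -- degree `0`: `c = s · 1 = pr_B^*(s · 1_B) ⌣ pr_Z^* 1_Z`
    have h1 : c ∈ Submodule.span ℂ {singularCohomology.one ℂ (ComplexPoints (B.X ⊗ Z.X))} :=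
      mem_divisorClassesSpan_zero (N := B.dim + Z.dim) (IsSmoothProjective.tensor_holds hB hZ) c
    obtain ⟨s, hs⟩ := Submodule.mem_span_singleton.1 h1
    refine mem_span_hodgeProductClasses_of_mem_span_pureType B Z hcQ hc (Submodule.subset_span ?_)
    refine ⟨0, 0, rfl, s • singularCohomology.one ℂ (ComplexPoints B.X), singularCohomology.one ℂ (ComplexPoints Z.X),
      ⟨0, rfl, isOfHodgeType_zero_zero_of_degree_zero hB _⟩,
      ⟨0, 0, rfl, isOfHodgeType_zero_zero_of_degree_zero hZ _⟩, ?_⟩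
    rw [← hs, map_smul, LinearMap.map_smul₂]
    erw [singularCohomology.map_one, singularCohomology.map_one, cupProduct_one]
  · obtain ⟨a, hca, hkill⟩ := hmain hp hcQ hc'
    -- the letters of `B × Z` over `A × S` are `pr_B^*`(letters of `B` over `A`) and `pr_Z^*`(letters of `Z` over `S`)
    set xA : (Fin n × Fin hA) × Fin 2 → complexBetti B.X 1 := fun jr =>
      complexBetti.map (gB jr.1.1).hom.hom.hom 1 (ofRatClassBaseChange (ComplexPoints A.X) 1 (bA (jr.1.2, jr.2)))
      with hxA
    set y : (Fin n × Fin h) × Fin 2 → complexBetti Z.X 1 := fun jr =>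
      complexBetti.map (gS jr.1.1).hom.hom.hom 1 (ofRatClassBaseChange (ComplexPoints S.X) 1 (cS (jr.1.2, jr.2)))
      with hy
    have hletters : (fun jr : (Fin n × (Fin hA ⊕ Fin h)) × Fin 2 => complexBetti.map
        (Motives.AbelianVariety.prodLift (Motives.AbelianVariety.fst B Z ≫ gB jr.1.1)
          (Motives.AbelianVariety.snd B Z ≫ gS jr.1.1)).hom.hom.hom 1
        (Sum.elim
          (fun i => complexBetti.map (Motives.AbelianVariety.fst A S).hom.hom.hom 1
            (ofRatClassBaseChange (ComplexPoints A.X) 1 (bA (i, jr.2))))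
          (fun i => complexBetti.map (Motives.AbelianVariety.snd A S).hom.hom.hom 1
            (ofRatClassBaseChange (ComplexPoints S.X) 1 (cS (i, jr.2))))
          jr.1.2)) =
        fun jr : (Fin n × (Fin hA ⊕ Fin h)) × Fin 2 => Sum.elim
          (fun i => complexBetti.map (Motives.AbelianVariety.fst B Z).hom.hom.hom 1 (xA ((jr.1.1, i), jr.2)))
          (fun i => complexBetti.map (Motives.AbelianVariety.snd B Z).hom.hom.hom 1 (y ((jr.1.1, i), jr.2)))
          jr.1.2 := by
      funext jr
      obtain ⟨⟨j, t⟩, κ⟩ := jr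
      rcases t with i | i
      · simp only [Sum.elim_inl, hxA]
        rw [complexBetti_map_map_hom, complexBetti_map_map_hom, Motives.AbelianVariety.prodLift_fst]
      · simp only [Sum.elim_inr, hy]
        rw [complexBetti_map_map_hom, complexBetti_map_map_hom, Motives.AbelianVariety.prodLift_snd]
    -- types of the letters
    have hxA0 : ∀ jr : (Fin n × Fin hA) × Fin 2, jr.2 = 0 → IsOfHodgeType B.dim B.X 1 1 0 (xA jr) := by
      rintro ⟨⟨j, i⟩, κ⟩ hκ
      change κ = 0 at hκ
      subst hκ
      exact (hbA0 i).map_of_isSmoothProjective hB hXA _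
    have hxA1 : ∀ jr : (Fin n × Fin hA) × Fin 2, jr.2 = 1 → IsOfHodgeType B.dim B.X 1 0 1 (xA jr) := by
      rintro ⟨⟨j, i⟩, κ⟩ hκ
      change κ = 1 at hκ
      subst hκ
      exact (hbA1 i).map_of_isSmoothProjective hB hXA _
    have hy0 : ∀ jr : (Fin n × Fin h) × Fin 2, jr.2 = 0 → IsOfHodgeType Z.dim Z.X 1 1 0 (y jr) := by
      rintro ⟨⟨j, i⟩, κ⟩ hκ
      change κ = 0 at hκ
      subst hκ
      exact (hcS0 i).map_of_isSmoothProjective hZ hXS _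
    have hy1 : ∀ jr : (Fin n × Fin h) × Fin 2, jr.2 = 1 → IsOfHodgeType Z.dim Z.X 1 0 1 (y jr) := by
      rintro ⟨⟨j, i⟩, κ⟩ hκ
      change κ = 1 at hκ
      subst hκ
      exact (hcS1 i).map_of_isSmoothProjective hZ hXS _
    -- evaluate and feed the typed criterion
    have hmem := wordEval_mem_span_typed_cup_pureType_of_eq_zero_off_balanced
      (Motives.AbelianVariety.fst B Z) (Motives.AbelianVariety.snd B Z) xA y hxA0 hxA1 hy0 hy1 hkill
    rw [← hletters, hca] at hmem
    refine mem_span_hodgeProductClasses_of_mem_span_pureType B Z hcQ hc (Submodule.span_mono ?_ hmem)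
    rintro z ⟨i, j, hij, d, μ, hd, hμ, rfl⟩
    exact ⟨i, j, hij, d, μ, hd, hμ, rfl⟩

/-- **`HodgeClassesProductSpan A S`** for `S` with `0 < dim S ≤ 3`, `End⁰(S) = ℚ` and `Hom_Hdg(H¹(S), H¹(A)) = 0`
(one slot on each side). [cite: MoonenZarhin1999LowDim, §2 (2.4), §3 (3.1) and Lemma (3.4)] -/
theorem hodgeClassesProductSpan_of_lowGeneric (hS0 : 0 < S.dim) (hS3 : S.dim ≤ 3)
    (hSend : Module.finrank ℚ S.endAlgebra = 1)
    (hHom : ∀ ψ : bettiCohomology S.X 1 →ₗ[ℚ] bettiCohomology A.X 1, IsHodgeMorphismOne A S ψ → ψ = 0) :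
    HodgeClassesProductSpan A S :=
  hodgeClassesProductSpan_of_avSlots_of_lowGeneric hS0 hS3 hSend hHom (avSlots_self A) (avSlots_self S)

/-- **All equal powers: `HodgeClassesProductSpan (A^{N+1}) (S^{N+1})`** (slots `avPowSlots` on both sides) —
Moonen–Zarhin (3.1) for `m = n`: the Hodge ring of `A^{N+1} × S^{N+1}` is generated by the classes coming from the
two factors. [cite: MoonenZarhin1999LowDim, §2 (2.4), §3 (3.1) and Lemma (3.4)] -/
theorem hodgeClassesProductSpan_powSucc_powSucc_of_lowGeneric (hS0 : 0 < S.dim) (hS3 : S.dim ≤ 3)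
    (hSend : Module.finrank ℚ S.endAlgebra = 1)
    (hHom : ∀ ψ : bettiCohomology S.X 1 →ₗ[ℚ] bettiCohomology A.X 1, IsHodgeMorphismOne A S ψ → ψ = 0) (N : ℕ) :
    HodgeClassesProductSpan (A.powSucc N) (S.powSucc N) :=
  hodgeClassesProductSpan_of_avSlots_of_lowGeneric hS0 hS3 hSend hHom (AVSlots.powSucc A N) (AVSlots.powSucc S N)

/-- **Geometric form: `Hom(A, S) = 0` ⟹ `HodgeClassesProductSpan (A^{N+1}) (S^{N+1})`** for `S` with
`0 < dim S ≤ 3`, `End⁰(S) = ℚ` (Riemann / Deligne–Milne 6.20 turns `Hom(A, S) = 0` into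
`Hom_Hdg(H¹(S), H¹(A)) = 0`). [cite: MoonenZarhin1999LowDim, §3 (3.1), Lemma (3.4) and §5 (5.4)]
[cite: DeligneMilne1982Tannakian, §6 Thm. 6.20] -/
theorem hodgeClassesProductSpan_powSucc_powSucc_of_lowGeneric_of_forall_hom_eq_zero (hS0 : 0 < S.dim)
    (hS3 : S.dim ≤ 3) (hSend : Module.finrank ℚ S.endAlgebra = 1) (hAS : ∀ u : A ⟶ S, u = 0) (N : ℕ) :
    HodgeClassesProductSpan (A.powSucc N) (S.powSucc N) :=
  hodgeClassesProductSpan_powSucc_powSucc_of_lowGeneric hS0 hS3 hSend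
    (forall_isHodgeMorphismOne_eq_zero_of_forall_hom_eq_zero_low hAS) N

/-- `HodgeClassesProductSpan A S` from `Hom(A, S) = 0`, `S` with `0 < dim S ≤ 3`, `End⁰(S) = ℚ`.
[cite: MoonenZarhin1999LowDim, §3 (3.1), Lemma (3.4) and §5 (5.4)] -/
theorem hodgeClassesProductSpan_of_lowGeneric_of_forall_hom_eq_zero (hS0 : 0 < S.dim) (hS3 : S.dim ≤ 3)
    (hSend : Module.finrank ℚ S.endAlgebra = 1) (hAS : ∀ u : A ⟶ S, u = 0) : HodgeClassesProductSpan A S :=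
  hodgeClassesProductSpan_of_lowGeneric hS0 hS3 hSend (forall_isHodgeMorphismOne_eq_zero_of_forall_hom_eq_zero_low hAS)

end ProductSpan

/-! ### §2 Condition (D) for `A × S` and the row `T × S`, `dim T ≤ 3` -/

section StablyNondegenerate

variable {A S T : AbelianVariety ℂ}

/-- **If `A` satisfies condition (D), `S` has `0 < dim S ≤ 3`, `End⁰(S) = ℚ` and `Hom(A, S) = 0`, then `A × S`
satisfies condition (D)** («`Hg(X × S) = Hg(X) × Hg(S)`», Moonen–Zarhin Lemma (3.4) with (2.4), and the §3 glue:
product span on all equal powers + (D) for both factors ⟹ (D) for the product; `S` is (D) by the dimension-`≤ 3`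
theorem `isStablyNondegenerate_of_dim_pos_of_dim_le_three`).
[cite: MoonenZarhin1999LowDim, §3 (3.1), Thm. (3.2), Lemma (3.4) and §5 (5.4)] [cite: Gordon1999HodgeAVSurvey, Def. 7.6] -/
theorem IsStablyNondegenerate.prod_lowGeneric_of_forall_hom_eq_zero (hA : IsStablyNondegenerate A)
    (hS0 : 0 < S.dim) (hS3 : S.dim ≤ 3) (hSend : Module.finrank ℚ S.endAlgebra = 1) (hAS : ∀ u : A ⟶ S, u = 0) :
    IsStablyNondegenerate (A.prod S) :=
  isStablyNondegenerate_prod_of_forall_productSpan_powSucc A S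
    (fun N => hodgeClassesProductSpan_powSucc_powSucc_of_lowGeneric_of_forall_hom_eq_zero hS0 hS3 hSend hAS N) hA
    (isStablyNondegenerate_of_dim_pos_of_dim_le_three hS0 hS3)

/-- The same with the factors in the order `S × A`. [cite: MoonenZarhin1999LowDim, §3 Thm. (3.2) and Lemma (3.4)] -/
theorem IsStablyNondegenerate.lowGeneric_prod_of_forall_hom_eq_zero (hA : IsStablyNondegenerate A)
    (hS0 : 0 < S.dim) (hS3 : S.dim ≤ 3) (hSend : Module.finrank ℚ S.endAlgebra = 1) (hAS : ∀ u : A ⟶ S, u = 0) :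
    IsStablyNondegenerate (S.prod A) :=
  isStablyNondegenerate_prod_of_forall_productSpan_powSucc S A
    (fun N => (hodgeClassesProductSpan_powSucc_powSucc_of_lowGeneric_of_forall_hom_eq_zero hS0 hS3 hSend hAS N).symm)
    (isStablyNondegenerate_of_dim_pos_of_dim_le_three hS0 hS3) hA

/-- All mixed powers `A^{a+1} × S^{b+1}` are then stably nondegenerate.
[cite: MoonenZarhin1999LowDim, §3 Thm. (3.2)] [cite: vanGeemen1994HodgeAV, §3.6 (p. 236)] -/
theorem IsStablyNondegenerate.powSucc_prod_lowGeneric_powSucc_of_forall_hom_eq_zero (hA : IsStablyNondegenerate A)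
    (hS0 : 0 < S.dim) (hS3 : S.dim ≤ 3) (hSend : Module.finrank ℚ S.endAlgebra = 1) (hAS : ∀ u : A ⟶ S, u = 0)
    (a b : ℕ) : IsStablyNondegenerate ((A.powSucc a).prod (S.powSucc b)) :=
  (hA.prod_lowGeneric_of_forall_hom_eq_zero hS0 hS3 hSend hAS).powSucc_prod_powSucc a b

/-- **THE ROW (Moonen–Zarhin Thm. 0.1 (4) / Thm. 0.2 (4) for `X = T × S`, `End⁰(S) = ℚ`, `Hom(T, S) = 0`): for ALL
complex abelian varieties `T`, `S` with `0 < dim T ≤ 3`, `0 < dim S ≤ 3`, `finrank_ℚ End⁰(S) = 1` and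
`Hom(T, S) = 0`, `T × S` is stably nondegenerate** (`B• = D•` on all powers) — `T` is (D) by the dimension-`≤ 3`
theorem (`isStablyNondegenerate_of_dim_pos_of_dim_le_three`), and the previous theorem.
[cite: MoonenZarhin1999LowDim, Thm. 0.1 (4), Thm. 0.2 (4), Lemma (3.4) and §5 (5.4)] [cite: vanGeemen1994HodgeAV, Thm. 4.3] -/
theorem isStablyNondegenerate_prod_lowGeneric_of_dim_le_three (h0 : 0 < T.dim) (h3 : T.dim ≤ 3)
    (hS0 : 0 < S.dim) (hS3 : S.dim ≤ 3) (hSend : Module.finrank ℚ S.endAlgebra = 1) (hTS : ∀ u : T ⟶ S, u = 0) :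
    IsStablyNondegenerate (T.prod S) :=
  (isStablyNondegenerate_of_dim_pos_of_dim_le_three h0 h3).prod_lowGeneric_of_forall_hom_eq_zero hS0 hS3 hSend hTS

/-- **The Hodge conjecture for every power `(T × S)^{N+1}`**, `dim T ≤ 3`, `dim S ≤ 3`, `End⁰(S) = ℚ`,
`Hom(T, S) = 0` — UNCONDITIONALLY. [cite: MoonenZarhin1999LowDim, Thm. 0.1 (4), Thm. 0.2 (4) and Lemma (3.4)]
[cite: vanGeemen1994HodgeAV, §2.4 and Lemma 3.7] -/
theorem hodgeConjectureFor_powSucc_prod_lowGeneric_of_dim_le_three (h0 : 0 < T.dim) (h3 : T.dim ≤ 3)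
    (hS0 : 0 < S.dim) (hS3 : S.dim ≤ 3) (hSend : Module.finrank ℚ S.endAlgebra = 1) (hTS : ∀ u : T ⟶ S, u = 0)
    (N : ℕ) : HodgeConjectureFor ((T.prod S).powSucc N).dim ((T.prod S).powSucc N).X :=
  (isStablyNondegenerate_prod_lowGeneric_of_dim_le_three h0 h3 hS0 hS3 hSend hTS).hodgeConjectureFor_powSucc N

/-- **The Hodge conjecture for `T × S` itself** (`N = 0`).
[cite: MoonenZarhin1999LowDim, Thm. 0.1 (4), Thm. 0.2 (4) and Lemma (3.4)] -/
theorem hodgeConjectureFor_prod_lowGeneric_of_dim_le_three (h0 : 0 < T.dim) (h3 : T.dim ≤ 3)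
    (hS0 : 0 < S.dim) (hS3 : S.dim ≤ 3) (hSend : Module.finrank ℚ S.endAlgebra = 1) (hTS : ∀ u : T ⟶ S, u = 0) :
    HodgeConjectureFor (T.prod S).dim (T.prod S).X :=
  (isStablyNondegenerate_prod_lowGeneric_of_dim_le_three h0 h3 hS0 hS3 hSend hTS).hodgeConjectureFor

/-- **The Hodge conjecture for everything isogenous to a power of `T × S`** (van Geemen Lemma 3.7).
[cite: MoonenZarhin1999LowDim, Thm. 0.1 (4) and Thm. 0.2 (4)] [cite: vanGeemen1994HodgeAV, Lemma 3.7] -/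
theorem hodgeConjectureFor_of_isIsogenous_powSucc_prod_lowGeneric_of_dim_le_three (h0 : 0 < T.dim)
    (h3 : T.dim ≤ 3) (hS0 : 0 < S.dim) (hS3 : S.dim ≤ 3) (hSend : Module.finrank ℚ S.endAlgebra = 1)
    (hTS : ∀ u : T ⟶ S, u = 0) {Y : AbelianVariety ℂ} {N : ℕ}
    (hY : AbelianVariety.IsIsogenous Y ((T.prod S).powSucc N)) : HodgeConjectureFor Y.dim Y.X :=
  (isStablyNondegenerate_prod_lowGeneric_of_dim_le_three h0 h3 hS0 hS3 hSend hTS).hodgeConjectureFor_of_isIsogenous_powSucc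
    hY

/-- Stable nondegeneracy of everything isogenous to `T × S`. [cite: MoonenZarhin1999LowDim, Thm. 0.1 (4) and Thm. 0.2 (4)]
[cite: vanGeemen1994HodgeAV, §3.6 (p. 236)] -/
theorem isStablyNondegenerate_of_isIsogenous_prod_lowGeneric_of_dim_le_three (h0 : 0 < T.dim) (h3 : T.dim ≤ 3)
    (hS0 : 0 < S.dim) (hS3 : S.dim ≤ 3) (hSend : Module.finrank ℚ S.endAlgebra = 1) (hTS : ∀ u : T ⟶ S, u = 0)
    {Y : AbelianVariety ℂ} (hY : AbelianVariety.IsIsogenous Y (T.prod S)) : IsStablyNondegenerate Y :=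
  (isStablyNondegenerate_prod_lowGeneric_of_dim_le_three h0 h3 hS0 hS3 hSend hTS).of_isIsogenous hY

end StablyNondegenerate

/-! ### §3 NO `Hom` HYPOTHESIS: a generic abelian surface or threefold times anything of dimension `≤ 3` -/

section NoHom

variable {S T T' Y : AbelianVariety ℂ}

/-- A homomorphism between SIMPLE abelian varieties of different dimensions vanishes (a non-zero one would be an
isogeny, `isIsogeny_of_isSimple_of_ne_zero`, preserving the dimension). [cite: MumfordAV1970, §19 Cor. 2 of Thm. 1 (p. 174)] -/
private theorem hom_eq_zero_of_isSimple_of_dim_ne_low {X Y : AbelianVariety ℂ} (hX : X.IsSimple) (hY : Y.IsSimple)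
    (h : X.dim ≠ Y.dim) (f : X ⟶ Y) : f = 0 := by
  by_contra hf
  exact h (dim_eq_of_isIsogeny (isIsogeny_of_isSimple_of_ne_zero hX hY f hf))

/-- Homomorphisms out of a product vanish when they vanish on both factors (`A × B ≅ A ⊞ B`, `biprod.hom_ext'`).
[cite: MumfordAV1970, §19 (p. 169)] -/
private theorem prod_hom_eq_zero_of_forall_low {A B C : AbelianVariety ℂ} (h₁ : ∀ f : A ⟶ C, f = 0)
    (h₂ : ∀ g : B ⟶ C, g = 0) (u : A.prod B ⟶ C) : u = 0 := by
  have h : (biprodIsoProd A B).hom ≫ u = 0 :=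
    biprod.hom_ext' _ _ (by rw [comp_zero]; exact h₁ _) (by rw [comp_zero]; exact h₂ _)
  rw [← Category.id_comp u, ← (biprodIsoProd A B).inv_hom_id, Category.assoc, h, comp_zero]

/-- `A × B ∼ B × A` (the swap isomorphism through `A × B ≅ A ⊞ B`). [cite: MumfordAV1970, §19 (p. 169)] -/
private theorem isIsogenous_prod_comm_low (A B : AbelianVariety ℂ) :
    AbelianVariety.IsIsogenous (A.prod B) (B.prod A) := by
  have h1 : AbelianVariety.IsIsogenous (A.prod B) (A ⊞ B) :=
    ⟨(biprodIsoProd A B).inv, isIsogeny_hom_of_iso (biprodIsoProd A B).symm⟩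
  have h3 : AbelianVariety.IsIsogenous (B ⊞ A) (B.prod A) :=
    ⟨(biprodIsoProd B A).hom, isIsogeny_hom_of_iso (biprodIsoProd B A)⟩
  exact (h1.trans (isIsogenous_biprod_comm A B)).trans h3

/-- **`End⁰(S) = ℚ` ⟹ `S` is simple** (`End⁰(S)` is then a field; Poincaré: a non-simple abelian variety has a
non-invertible non-zero endomorphism). [cite: MumfordAV1970, §19 Thm. 1 and Cor. 2 (pp. 173–174)] -/
theorem isSimple_of_finrank_endAlgebra_eq_one_low (hSend : Module.finrank ℚ S.endAlgebra = 1) : S.IsSimple :=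
  isSimple_of_isField_endAlgebra (isField_endAlgebra_of_finrank_eq_one hSend)

/-- **`Y × S` for `0 < dim Y ≤ 2` and `S` an abelian SURFACE with `End⁰(S) = ℚ` satisfies condition (D)** — NO
`Hom` hypothesis (abelian threefolds `E × S` and FOURFOLDS `S' × S`; Moonen–Zarhin Thm. 0.1 (4): the exceptional
fourfolds (a)–(d) have no isogeny factor `S` with `dim S = 2`, `End⁰(S) = ℚ`). CASES: `Y` simple and
`Hom(Y, S) = 0` ⟹ the row; `Y` simple and `Hom(Y, S) ≠ 0` ⟹ `Y ∼ S` (a non-zero homomorphism of simple abelian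
varieties is an isogeny), `Y × S ∼ S × S`, powers of `S`; `Y` not simple ⟹ `Y ∼ E₁ × E₂` and
`Hom(E₁ × E₂, S) = 0` (`S` simple of dimension `2 ≠ 1`), the row for `(E₁ × E₂) × S`.
[cite: MoonenZarhin1999LowDim, Thm. 0.1 (4), §2 (2.2), Lemma (3.4) and §5 (5.2)]
[cite: MumfordAV1970, §19 Thm. 1 and Cor. 2 (pp. 173–174)] -/
theorem isStablyNondegenerate_prod_genericSurface_of_dim_le_two (h0 : 0 < Y.dim) (h2 : Y.dim ≤ 2)
    (hS2 : S.dim = 2) (hSend : Module.finrank ℚ S.endAlgebra = 1) : IsStablyNondegenerate (Y.prod S) := by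
  classical
  have hSs : S.IsSimple := isSimple_of_finrank_endAlgebra_eq_one_low hSend
  have hSD : IsStablyNondegenerate S := isStablyNondegenerate_of_dim_pos_of_dim_le_three (by omega) (by omega)
  by_cases hYs : Y.IsSimple
  · by_cases hYS : ∀ u : Y ⟶ S, u = 0
    · exact isStablyNondegenerate_prod_lowGeneric_of_dim_le_three h0 (by omega) (by omega) (by omega) hSend hYS
    · obtain ⟨u, hu⟩ := not_forall.1 hYS
      have hYiso : AbelianVariety.IsIsogenous Y S := ⟨u, isIsogeny_of_isSimple_of_ne_zero hYs hSs u hu⟩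
      -- `S × S = S.powSucc 1` (definitionally), a power of the stably nondegenerate `S`
      have hSS : IsStablyNondegenerate (S.prod S) := hSD.powSucc 1
      exact hSS.of_isIsogenous (hYiso.prod (AbelianVariety.IsIsogenous.refl S))
  · have hY2 : Y.dim = 2 := by
      by_contra hY2
      exact hYs (isSimple_of_dim_le_one (by omega))
    obtain ⟨E₁, E₂, h₁, h₂, hY⟩ := exists_curve_prod_curve_isIsogenous_of_not_isSimple_surface hY2 hYs
    have hHom : ∀ u : E₁.prod E₂ ⟶ S, u = 0 :=
      prod_hom_eq_zero_of_forall_low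
        (hom_eq_zero_of_isSimple_of_dim_ne_low (isSimple_of_dim_le_one h₁.le) hSs (by omega))
        (hom_eq_zero_of_isSimple_of_dim_ne_low (isSimple_of_dim_le_one h₂.le) hSs (by omega))
    exact (isStablyNondegenerate_prod_lowGeneric_of_dim_le_three (T := E₁.prod E₂) (by rw [dim_prod]; omega)
      (by rw [dim_prod]; omega) (by omega) (by omega) hSend hHom).of_isIsogenous'
      (hY.prod (AbelianVariety.IsIsogenous.refl S))

/-- **`Y × T'` for `0 < dim Y ≤ 2` and `T'` an abelian THREEFOLD with `End⁰(T') = ℚ` satisfies condition (D)** —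
NO `Hom` hypothesis (fourfolds `E × T'`, FIVEFOLDS `S' × T'`; Thm. 0.1 (4), Thm. 0.2 (4)): `Hom(Y, T') = 0`
automatically — `T'` is simple of dimension `3`, and `Y` is simple of dimension `≤ 2` or `Y ∼ E₁ × E₂`.
[cite: MoonenZarhin1999LowDim, Thm. 0.1 (4), Thm. 0.2 (4), §2 (2.3) and Lemma (3.4)]
[cite: MumfordAV1970, §19 Thm. 1 and Cor. 2 (pp. 173–174)] -/
theorem isStablyNondegenerate_prod_genericThreefold_of_dim_le_two (h0 : 0 < Y.dim) (h2 : Y.dim ≤ 2)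
    (hT'3 : T'.dim = 3) (hT'end : Module.finrank ℚ T'.endAlgebra = 1) : IsStablyNondegenerate (Y.prod T') := by
  classical
  have hT's : T'.IsSimple := isSimple_of_finrank_endAlgebra_eq_one_low hT'end
  by_cases hYs : Y.IsSimple
  · exact isStablyNondegenerate_prod_lowGeneric_of_dim_le_three h0 (by omega) (by omega) hT'3.le hT'end
      (hom_eq_zero_of_isSimple_of_dim_ne_low hYs hT's (by omega))
  · have hY2 : Y.dim = 2 := by
      by_contra hY2
      exact hYs (isSimple_of_dim_le_one (by omega))
    obtain ⟨E₁, E₂, h₁, h₂, hY⟩ := exists_curve_prod_curve_isIsogenous_of_not_isSimple_surface hY2 hYs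
    have hHom : ∀ u : E₁.prod E₂ ⟶ T', u = 0 :=
      prod_hom_eq_zero_of_forall_low
        (hom_eq_zero_of_isSimple_of_dim_ne_low (isSimple_of_dim_le_one h₁.le) hT's (by omega))
        (hom_eq_zero_of_isSimple_of_dim_ne_low (isSimple_of_dim_le_one h₂.le) hT's (by omega))
    exact (isStablyNondegenerate_prod_lowGeneric_of_dim_le_three (T := E₁.prod E₂) (by rw [dim_prod]; omega)
      (by rw [dim_prod]; omega) (by omega) hT'3.le hT'end hHom).of_isIsogenous'
      (hY.prod (AbelianVariety.IsIsogenous.refl T'))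

/-- **`S × S × E'` — the square of a surface `S` with `End⁰(S) = ℚ` times ANY elliptic curve `E'` — satisfies
(D)**: `E'` without complex multiplication ⟹ `Hom(S × S, E') = 0` (`S` simple of dimension `2 ≠ 1`) and the §2 row
with the generic CURVE `E'` as second factor; `E'` of CM type (`dim_ℚ End⁰(E') = 2`) ⟹ the R5 row «no factor of
Type IV times a CM curve» (`End⁰(S) = ℚ` is totally real: `hasNoTypeIVFactor_of_finrank_endAlgebra_eq_one`,
`HasNoTypeIVFactor.prod`). [cite: MoonenZarhin1999LowDim, Thm. 0.2 (4), §3 Thm. (3.2)(2), Lemma (3.4) and Prop. (3.8)]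
[cite: SilvermanAEC2009, III.9 Cor. 9.4] -/
theorem isStablyNondegenerate_genericSurface_prod_self_prod_curve {E' : AbelianVariety ℂ} (hS2 : S.dim = 2)
    (hSend : Module.finrank ℚ S.endAlgebra = 1) (hE'1 : E'.dim = 1) :
    IsStablyNondegenerate ((S.prod S).prod E') := by
  have hSs : S.IsSimple := isSimple_of_finrank_endAlgebra_eq_one_low hSend
  have hSD : IsStablyNondegenerate S := isStablyNondegenerate_of_dim_pos_of_dim_le_three (by omega) (by omega)
  have hSS : IsStablyNondegenerate (S.prod S) := hSD.powSucc 1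
  have hE's : E'.IsSimple := isSimple_of_dim_le_one hE'1.le
  rcases Literature.NumberTheory.ComplexMultiplication.finrank_endAlgebra_eq_one_or_two (A₀ := E') hE'1 with
    h1 | h2
  · -- `E'` without complex multiplication: `Hom(S × S, E') = 0`, the row with `E'` as the generic factor
    have hHom : ∀ u : S.prod S ⟶ E', u = 0 :=
      prod_hom_eq_zero_of_forall_low
        (hom_eq_zero_of_isSimple_of_dim_ne_low hSs hE's (by omega))
        (hom_eq_zero_of_isSimple_of_dim_ne_low hSs hE's (by omega))
    exact hSS.prod_lowGeneric_of_forall_hom_eq_zero (by omega) (by omega) h1 hHom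
  · -- `E'` of CM type: no factor of Type IV times a CM curve
    have hcm : IsOfCMType E' :=
      (Literature.NumberTheory.ComplexMultiplication.EllipticCurve.isOfCMType_iff_finrank_end_eq_two hE'1).2
        (by rw [Literature.NumberTheory.ComplexMultiplication.AbelianVariety.finrank_int_end_eq_finrank_endAlgebra]
            exact h2)
    exact hSS.prod_cmCurve_of_hasNoTypeIVFactor
      ((hasNoTypeIVFactor_of_finrank_endAlgebra_eq_one hSend).prod (hasNoTypeIVFactor_of_finrank_endAlgebra_eq_one hSend))
      hE'1 hcm

/-- **THE FIVEFOLD THEOREM: `T × S` for EVERY abelian threefold `T` and every abelian SURFACE `S` with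
`End⁰(S) = ℚ` satisfies condition (D)** — NO `Hom` hypothesis (Moonen–Zarhin Thm. 0.2 (4): the exceptional
fivefolds (e)–(g) have no isogeny factor `S` with `dim S = 2`, `End⁰(S) = ℚ`). CASES (Poincaré): `T` simple ⟹
`Hom(T, S) = 0`, the row; `T ∼ E' × S''` with `S''` not simple ⟹ `T ∼ E' × E₁ × E₂`, `Hom = 0`, the row; `S''`
simple with `Hom(S'', S) = 0` ⟹ `Hom(E' × S'', S) = 0`, the row; `S''` simple with `Hom(S'', S) ≠ 0` ⟹ `S'' ∼ S`,
`T × S ∼ S × S × E'` (`isStablyNondegenerate_genericSurface_prod_self_prod_curve`).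
[cite: MoonenZarhin1999LowDim, Thm. 0.2 (4), §2 (2.2), Lemma (3.4), Prop. (3.8) and §5 (5.2)]
[cite: MumfordAV1970, §19 Thm. 1 and Cor. 2 (pp. 173–174)] -/
theorem isStablyNondegenerate_threefold_prod_genericSurface (hT3 : T.dim = 3) (hS2 : S.dim = 2)
    (hSend : Module.finrank ℚ S.endAlgebra = 1) : IsStablyNondegenerate (T.prod S) := by
  classical
  have hSs : S.IsSimple := isSimple_of_finrank_endAlgebra_eq_one_low hSend
  by_cases hTs : T.IsSimple
  · exact isStablyNondegenerate_prod_lowGeneric_of_dim_le_three (by omega) hT3.le (by omega) (by omega) hSend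
      (hom_eq_zero_of_isSimple_of_dim_ne_low hTs hSs (by omega))
  obtain ⟨E', S'', hE'1, hS''2, hT⟩ := exists_curve_prod_surface_isIsogenous_of_not_isSimple_threefold hT3 hTs
  have hX : AbelianVariety.IsIsogenous ((E'.prod S'').prod S) (T.prod S) := hT.prod (AbelianVariety.IsIsogenous.refl S)
  have hE'0 : ∀ f : E' ⟶ S, f = 0 :=
    hom_eq_zero_of_isSimple_of_dim_ne_low (isSimple_of_dim_le_one hE'1.le) hSs (by omega)
  by_cases hS''s : S''.IsSimple
  · by_cases hS''S : ∀ g : S'' ⟶ S, g = 0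
    · -- `Hom(E' × S'', S) = 0`: the row for the threefold `E' × S''`
      exact (isStablyNondegenerate_prod_lowGeneric_of_dim_le_three (T := E'.prod S'') (by rw [dim_prod]; omega)
        (by rw [dim_prod]; omega) (by omega) (by omega) hSend (prod_hom_eq_zero_of_forall_low hE'0 hS''S)).of_isIsogenous'
        hX
    · -- `S'' ∼ S`: `T × S ∼ (E' × S) × S ∼ S × (E' × S) ∼ S × (S × E') ∼ (S × S) × E'`
      obtain ⟨g, hg⟩ := not_forall.1 hS''S
      have hS''iso : AbelianVariety.IsIsogenous S'' S := ⟨g, isIsogeny_of_isSimple_of_ne_zero hS''s hSs g hg⟩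
      have h1 : AbelianVariety.IsIsogenous ((E'.prod S'').prod S) ((E'.prod S).prod S) :=
        ((AbelianVariety.IsIsogenous.refl E').prod hS''iso).prod (AbelianVariety.IsIsogenous.refl S)
      have h2 : AbelianVariety.IsIsogenous ((E'.prod S).prod S) (S.prod (E'.prod S)) := isIsogenous_prodRotate E' S S
      have h3 : AbelianVariety.IsIsogenous (S.prod (E'.prod S)) (S.prod (S.prod E')) :=
        (AbelianVariety.IsIsogenous.refl S).prod (isIsogenous_prod_comm_low E' S)
      have hD : IsStablyNondegenerate (S.prod (S.prod E')) :=
        (isStablyNondegenerate_genericSurface_prod_self_prod_curve hS2 hSend hE'1).of_isIsogenous'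
          (isIsogenous_prodRotate S S E')
      exact (((hD.of_isIsogenous h3).of_isIsogenous h2).of_isIsogenous h1).of_isIsogenous' hX
  · -- `S'' ∼ E₁ × E₂`: `T ∼ E' × (E₁ × E₂)`, `Hom(·, S) = 0`
    obtain ⟨E₁, E₂, h₁, h₂, hS''⟩ := exists_curve_prod_curve_isIsogenous_of_not_isSimple_surface hS''2 hS''s
    have hHom : ∀ u : E'.prod (E₁.prod E₂) ⟶ S, u = 0 :=
      prod_hom_eq_zero_of_forall_low hE'0 (prod_hom_eq_zero_of_forall_low
        (hom_eq_zero_of_isSimple_of_dim_ne_low (isSimple_of_dim_le_one h₁.le) hSs (by omega))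
        (hom_eq_zero_of_isSimple_of_dim_ne_low (isSimple_of_dim_le_one h₂.le) hSs (by omega)))
    have hiso : AbelianVariety.IsIsogenous ((E'.prod (E₁.prod E₂)).prod S) ((E'.prod S'').prod S) :=
      ((AbelianVariety.IsIsogenous.refl E').prod hS'').prod (AbelianVariety.IsIsogenous.refl S)
    exact ((isStablyNondegenerate_prod_lowGeneric_of_dim_le_three (T := E'.prod (E₁.prod E₂))
      (by rw [dim_prod, dim_prod]; omega) (by rw [dim_prod, dim_prod]; omega) (by omega) (by omega) hSend
      hHom).of_isIsogenous' hiso).of_isIsogenous' hX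

/-- **THE SIXFOLD THEOREM: `T × T'` for EVERY abelian threefold `T` and every abelian THREEFOLD `T'` with
`End⁰(T') = ℚ` satisfies condition (D)** — NO `Hom` hypothesis (Lemma (3.4) with (2.4): `hg(T') = 𝔰𝔭₆`).
CASES: `T` simple and `Hom(T, T') = 0` ⟹ the row; `T` simple and `Hom(T, T') ≠ 0` ⟹ `T ∼ T'`, `T × T' ∼ T' × T'`,
powers of `T'` (`T'` is (D)); `T ∼ E' × S''` ⟹ `Hom(E' × S'', T') = 0` (`T'` simple of dimension `3`; `S''` simple
of dimension `2` or `S'' ∼ E₁ × E₂`), the row.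
[cite: MoonenZarhin1999LowDim, §2 (2.3)–(2.4), §3 (3.1), Thm. (3.2) and Lemma (3.4)]
[cite: MumfordAV1970, §19 Thm. 1 and Cor. 2 (pp. 173–174)] -/
theorem isStablyNondegenerate_threefold_prod_genericThreefold (hT3 : T.dim = 3) (hT'3 : T'.dim = 3)
    (hT'end : Module.finrank ℚ T'.endAlgebra = 1) : IsStablyNondegenerate (T.prod T') := by
  classical
  have hT's : T'.IsSimple := isSimple_of_finrank_endAlgebra_eq_one_low hT'end
  have hT'D : IsStablyNondegenerate T' := isStablyNondegenerate_of_dim_pos_of_dim_le_three (by omega) hT'3.le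
  by_cases hTs : T.IsSimple
  · by_cases hTT : ∀ u : T ⟶ T', u = 0
    · exact isStablyNondegenerate_prod_lowGeneric_of_dim_le_three (by omega) hT3.le (by omega) hT'3.le hT'end hTT
    · obtain ⟨u, hu⟩ := not_forall.1 hTT
      have hTiso : AbelianVariety.IsIsogenous T T' := ⟨u, isIsogeny_of_isSimple_of_ne_zero hTs hT's u hu⟩
      have hTT' : IsStablyNondegenerate (T'.prod T') := hT'D.powSucc 1
      exact hTT'.of_isIsogenous (hTiso.prod (AbelianVariety.IsIsogenous.refl T'))
  obtain ⟨E', S'', hE'1, hS''2, hT⟩ := exists_curve_prod_surface_isIsogenous_of_not_isSimple_threefold hT3 hTs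
  have hX : AbelianVariety.IsIsogenous ((E'.prod S'').prod T') (T.prod T') :=
    hT.prod (AbelianVariety.IsIsogenous.refl T')
  have hE'0 : ∀ f : E' ⟶ T', f = 0 :=
    hom_eq_zero_of_isSimple_of_dim_ne_low (isSimple_of_dim_le_one hE'1.le) hT's (by omega)
  by_cases hS''s : S''.IsSimple
  · exact (isStablyNondegenerate_prod_lowGeneric_of_dim_le_three (T := E'.prod S'') (by rw [dim_prod]; omega)
      (by rw [dim_prod]; omega) (by omega) hT'3.le hT'end (prod_hom_eq_zero_of_forall_low hE'0
        (hom_eq_zero_of_isSimple_of_dim_ne_low hS''s hT's (by omega)))).of_isIsogenous' hX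
  · obtain ⟨E₁, E₂, h₁, h₂, hS''⟩ := exists_curve_prod_curve_isIsogenous_of_not_isSimple_surface hS''2 hS''s
    have hHom : ∀ u : E'.prod (E₁.prod E₂) ⟶ T', u = 0 :=
      prod_hom_eq_zero_of_forall_low hE'0 (prod_hom_eq_zero_of_forall_low
        (hom_eq_zero_of_isSimple_of_dim_ne_low (isSimple_of_dim_le_one h₁.le) hT's (by omega))
        (hom_eq_zero_of_isSimple_of_dim_ne_low (isSimple_of_dim_le_one h₂.le) hT's (by omega)))
    have hiso : AbelianVariety.IsIsogenous ((E'.prod (E₁.prod E₂)).prod T') ((E'.prod S'').prod T') :=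
      ((AbelianVariety.IsIsogenous.refl E').prod hS'').prod (AbelianVariety.IsIsogenous.refl T')
    exact ((isStablyNondegenerate_prod_lowGeneric_of_dim_le_three (T := E'.prod (E₁.prod E₂))
      (by rw [dim_prod, dim_prod]; omega) (by rw [dim_prod, dim_prod]; omega) (by omega) hT'3.le hT'end
      hHom).of_isIsogenous' hiso).of_isIsogenous' hX

/-- The same products in the other order: `S × Y`, `S` a surface with `End⁰(S) = ℚ`, `0 < dim Y ≤ 3`.
[cite: MoonenZarhin1999LowDim, Thm. 0.1 (4) and Thm. 0.2 (4)] -/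
theorem isStablyNondegenerate_genericSurface_prod_of_dim_le_three (hS2 : S.dim = 2)
    (hSend : Module.finrank ℚ S.endAlgebra = 1) (h0 : 0 < Y.dim) (h3 : Y.dim ≤ 3) :
    IsStablyNondegenerate (S.prod Y) := by
  rcases Nat.lt_or_ge Y.dim 3 with hY | hY
  · exact (isStablyNondegenerate_prod_genericSurface_of_dim_le_two h0 (by omega) hS2 hSend).of_isIsogenous
      (isIsogenous_prod_comm_low S Y)
  · exact (isStablyNondegenerate_threefold_prod_genericSurface (by omega) hS2 hSend).of_isIsogenous
      (isIsogenous_prod_comm_low S Y)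

/-- **Summary: `Y × S` satisfies (D) for EVERY `Y` with `0 < dim Y ≤ 3` and every `S` with `dim S ∈ {2, 3}` and
`End⁰(S) = ℚ`** (abelian varieties of dimension `3 ≤ dim ≤ 6` with a generic surface or threefold factor and a
cofactor of dimension `≤ 3`). [cite: MoonenZarhin1999LowDim, Thm. 0.1 (4), Thm. 0.2 (4), §2 (2.4) and Lemma (3.4)] -/
theorem isStablyNondegenerate_prod_generic_of_dim_le_three (h0 : 0 < Y.dim) (h3 : Y.dim ≤ 3) (hS2 : 2 ≤ S.dim)
    (hS3 : S.dim ≤ 3) (hSend : Module.finrank ℚ S.endAlgebra = 1) : IsStablyNondegenerate (Y.prod S) := by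
  rcases Nat.lt_or_ge Y.dim 3 with hY | hY <;> rcases Nat.lt_or_ge S.dim 3 with hS | hS
  · exact isStablyNondegenerate_prod_genericSurface_of_dim_le_two h0 (by omega) (by omega) hSend
  · exact isStablyNondegenerate_prod_genericThreefold_of_dim_le_two h0 (by omega) (by omega) hSend
  · exact isStablyNondegenerate_threefold_prod_genericSurface (by omega) (by omega) hSend
  · exact isStablyNondegenerate_threefold_prod_genericThreefold (by omega) (by omega) hSend

/-- **Everything isogenous to such a `Y × S` is stably nondegenerate.**
[cite: MoonenZarhin1999LowDim, Thm. 0.1 (4) and Thm. 0.2 (4)] [cite: vanGeemen1994HodgeAV, §3.6 (p. 236)] -/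
theorem isStablyNondegenerate_of_isIsogenous_prod_generic_of_dim_le_three (h0 : 0 < Y.dim) (h3 : Y.dim ≤ 3)
    (hS2 : 2 ≤ S.dim) (hS3 : S.dim ≤ 3) (hSend : Module.finrank ℚ S.endAlgebra = 1) {X : AbelianVariety ℂ}
    (hX : AbelianVariety.IsIsogenous X (Y.prod S)) : IsStablyNondegenerate X :=
  (isStablyNondegenerate_prod_generic_of_dim_le_three h0 h3 hS2 hS3 hSend).of_isIsogenous hX

/-- **The Hodge conjecture for every power of every abelian variety isogenous to `Y × S`** (`0 < dim Y ≤ 3`,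
`dim S ∈ {2, 3}`, `End⁰(S) = ℚ`) — UNCONDITIONALLY (no HC_CM).
[cite: MoonenZarhin1999LowDim, Thm. 0.1 (4) and Thm. 0.2 (4)] [cite: vanGeemen1994HodgeAV, §2.4 and Lemma 3.7] -/
theorem hodgeConjectureFor_powSucc_of_isIsogenous_prod_generic_of_dim_le_three (h0 : 0 < Y.dim) (h3 : Y.dim ≤ 3)
    (hS2 : 2 ≤ S.dim) (hS3 : S.dim ≤ 3) (hSend : Module.finrank ℚ S.endAlgebra = 1) {X : AbelianVariety ℂ}
    (hX : AbelianVariety.IsIsogenous X (Y.prod S)) (N : ℕ) :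
    HodgeConjectureFor (X.powSucc N).dim (X.powSucc N).X :=
  (isStablyNondegenerate_of_isIsogenous_prod_generic_of_dim_le_three h0 h3 hS2 hS3 hSend hX).hodgeConjectureFor_powSucc N

/-- **The Hodge conjecture for every abelian variety isogenous to `Y × S`** (`0 < dim Y ≤ 3`, `dim S ∈ {2, 3}`,
`End⁰(S) = ℚ`). [cite: MoonenZarhin1999LowDim, Thm. 0.1 (4) and Thm. 0.2 (4)] -/
theorem hodgeConjectureFor_of_isIsogenous_prod_generic_of_dim_le_three (h0 : 0 < Y.dim) (h3 : Y.dim ≤ 3)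
    (hS2 : 2 ≤ S.dim) (hS3 : S.dim ≤ 3) (hSend : Module.finrank ℚ S.endAlgebra = 1) {X : AbelianVariety ℂ}
    (hX : AbelianVariety.IsIsogenous X (Y.prod S)) : HodgeConjectureFor X.dim X.X :=
  (isStablyNondegenerate_of_isIsogenous_prod_generic_of_dim_le_three h0 h3 hS2 hS3 hSend hX).hodgeConjectureFor

/-- **The Hodge conjecture for `Y × S` itself** (e.g. the SIXFOLDS `T × T'`, `T'` a generic threefold).
[cite: MoonenZarhin1999LowDim, Thm. 0.1 (4), Thm. 0.2 (4) and Lemma (3.4)] -/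
theorem hodgeConjectureFor_prod_generic_of_dim_le_three (h0 : 0 < Y.dim) (h3 : Y.dim ≤ 3) (hS2 : 2 ≤ S.dim)
    (hS3 : S.dim ≤ 3) (hSend : Module.finrank ℚ S.endAlgebra = 1) :
    HodgeConjectureFor (Y.prod S).dim (Y.prod S).X :=
  (isStablyNondegenerate_prod_generic_of_dim_le_three h0 h3 hS2 hS3 hSend).hodgeConjectureFor

end NoHom

end Literature.AlgebraicGeometry.HodgeTheory

end
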